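import Summits.Ventures.LatticeQCDFlow.Exactness.AnytimeValidAverages
import Summits.Ventures.LatticeQCDFlow.Exactness.IMHCoupledEstimatorEquilibriumBernsteinUnboundedWeights
import HarnessLib

/-!
# Anytime-valid error bars for the flow sampler's parallel short runs and for the coupled estimator: valid at EVERY number of
# replicas at once (readouts), or at every number up to a declared budget (coupled estimator), for every weight

HONEST FRAMING: exact (Metropolis-corrected) sampling algorithms for lattice gauge theory;
figures of merit are autocorrelation/cost numbers at stated couplings and volumes; no
continuum-physics claim.

Venture `LatticeQCDFlow` (cell pub-lqcd), topic `Exactness`; FANOUT row 30 (lean-1, GEN-41).  NEW WORK of the cell: the IMH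
application of GEN-41's `Exactness/AnytimeValidAverages`.  Setting as in GEN-40's `IMHCoupledEstimatorBernsteinUnboundedWeights`:
`K = indepMH q w` the exact flow sampler (proposal law `q`, positive `Fact`-measurable weight `w`, target `π = w·q`), `K̂` a CRN pair
kernel, `Z_0, Z_1, …` mutually independent pair streams with the pair-chain law from one initial coupling `ν̂`, `Y_k^{(j)} = (Z_j k).2`
the production run of replica `j` read after `k` discarded updates, `H_{k,N}(Z_j)` the coupled (burn-in-free) estimator, `a ≤ f ≤ c`
measurable, `m_k = (ν̂₂K^k) f`.  Every bar below holds with NO HYPOTHESIS ON THE WEIGHT beyond positivity and normalisation.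

* §1 (readouts, any start) **`crnLag_replicas_readout_hoeffding_abs_anytime`** — for radii `ε_R ≥ 0` and a summable schedule
  `δ_R ≥ 0` with `2·exp(−2Rε_R²/(c − a)²) ≤ δ_R` (`R ≥ 1`): `P(∃ R ≥ 1, |R⁻¹Σ_{j<R} f(Y_k^{(j)}) − m_k| ≥ ε_R) ≤ Σ_R δ_R`;
  **`crnLag_replicas_readout_bernstein_abs_anytime`** — the same with `2·exp(−Rε_R²/(2(σ² + (c − a)ε_R/3))) ≤ δ_R`, `σ² ≥ Var_{ν̂₂K^k} f`.
* §2 (readouts about `π f`, the practical start `ν̂_x = K(x, ·)∘(y ↦ (y, x))⁻¹`, `w(x) ≤ M`, standard Borel `Ω`; `c₁ = E_q[min(1, w)]`,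
  `ρ = 1 − c₁/max(1, M)`, `τ = π{M < w} + ρ^k`) **`imh_replicas_readout_hoeffding_abs_anytime_target_everyWeight`** —
  `P(∃ R ≥ 1, |R⁻¹Σ_{j<R} f(Y_k^{(j)}) − π f| ≥ ε_R + (c − a)τ) ≤ Σ_R δ_R`: THE PARALLEL-SHORT-RUNS ESTIMATE (many independent exact
  runs from `x`, each read once after `k` updates) carries an anytime-valid Hoeffding bar with NO coupling term at all — the bias
  allowance `(c − a)τ` is GEN-40's every-start observable rate; **`…_bernstein_…_equilibrium_everyWeight`** — the Bernstein form at the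
  equilibrium variance, `σ² = Var_π f + 3(c − a)²τ` (GEN-40's `variance_iterate_bind_indepMH_dirac_le_tail`).
* §3 (the coupled estimator, any start, within a declared budget `R_max`) **`crnLag_replicas_burnIn_hoeffding_abs_anytime_budget`** —
  `P(∃ 1 ≤ R ≤ R_max, |H̄_R − m_k| ≥ ε_R) ≤ Σ_R δ_R + R_max·(ν̂K̂^k)(Δᶜ)`: off the event that one of the `R_max` replicas still carries
  a correction after the burn-in, EVERY partial average `H̄_R`, `R ≤ R_max`, is the read-out average; the Bernstein form
  **`crnLag_replicas_burnIn_bernstein_abs_anytime_budget`**; and about `π f` from the practical start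
  **`imh_replicas_burnIn_bernstein_abs_anytime_budget_target_everyWeight`** —
  `P(∃ 1 ≤ R ≤ R_max, |H̄_R − π f| ≥ ε_R + (c − a)τ) ≤ Σ_R δ_R + R_max·(q{M < w} + ρ^k)`.
Reading (gauge files): the bar printed after EACH new replica of the exact gauge sampler is honest simultaneously for all of them
(stop when it is small enough) at the price `log(4(R + 1)(R + 2)/δ)` for `log(4/δ)`; the coupled estimator pays its coupling term once
for the declared budget.  NOT CLAIMED: a budget-free anytime bar for the coupled estimator (over infinitely many replicas some replica
carries a correction a.s. when `(ν̂K̂^k)(Δᶜ) > 0`); data-dependent burn-in `k`.  No `sorry`, no new definitions, nothing cited as a fact.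
-/

noncomputable section
namespace Summit.Ventures.LatticeQCDFlow.Exactness

open MeasureTheory ProbabilityTheory Function Finset Filter
open scoped _root_.ENNReal unitInterval Topology
open Summit.Ventures.LatticeQCDFlow.Scoring
variable {Ω : Type*} [MeasurableSpace Ω] {q : Measure Ω} [IsProbabilityMeasure q] {w : Ω → ℝ}

section Replicas
variable {Ω' : Type*} {mΩ' : MeasurableSpace Ω'} {μ : Measure Ω'} [IsProbabilityMeasure μ]
  {Z : ℕ → Ω' → (ℕ → Ω × Ω)}
/-! ## §1 Readouts of parallel runs, any start: anytime Hoeffding and Bernstein about `m_k` -/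

omit [IsProbabilityMeasure μ] in
/-- The read-outs `f(Y_k^{(j)})`: measurable, mutually independent, in `[a, c]`, common mean `m_k = (ν̂₂K^k) f`. [ours, bookkeeping] -/
theorem crnLag_replicas_readout_facts [Fact (Measurable w)] (hw0 : ∀ y, 0 < w y)
    (Khat : Kernel (Ω × Ω) (Ω × Ω)) [IsMarkovKernel Khat]
    (hK : ∀ z : Ω × Ω, Khat z = (q.prod (volume : Measure unitInterval)).map (fun p : Ω × unitInterval =>
      ((if (p.2 : ℝ) * w z.1 ≤ w p.1 then p.1 else z.1), (if (p.2 : ℝ) * w z.2 ≤ w p.1 then p.1 else z.2))))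
    (ν : Measure (Ω × Ω)) [IsProbabilityMeasure ν] {f : Ω → ℝ} (hf : Measurable f) {a c : ℝ} (ha : ∀ x, a ≤ f x)
    (hc : ∀ x, f x ≤ c) (k : ℕ) (hZm : ∀ j, Measurable (Z j))
    (hlaw : ∀ j, μ.map (Z j) = Kernel.trajMeasure (X := fun _ : ℕ => Ω × Ω) ν
      (fun n : ℕ => Khat.comap (fun h : (i : ↥(Finset.Iic n)) → Ω × Ω => h ⟨n, Finset.mem_Iic.2 le_rfl⟩)
        (measurable_pi_apply _)))
    (hind : iIndepFun Z μ) :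
    (∀ j, Measurable fun ω => f ((Z j ω k).2)) ∧ iIndepFun (fun j ω => f ((Z j ω k).2)) μ ∧
      (∀ j ω, f ((Z j ω k).2) ∈ Set.Icc a c) ∧
      ∀ j, μ[fun ω => f ((Z j ω k).2)] = ∫ y, f y ∂((fun m : Measure Ω => m.bind (indepMH q w))^[k] (ν.map Prod.snd)) := by
  have hFm : Measurable fun z : ℕ → Ω × Ω => f ((z k).2) := hf.comp (measurable_snd.comp (measurable_pi_apply k))
  have hC : ∀ x, |f x| ≤ max |a| |c| := fun x => abs_le_max_abs_abs (ha x) (hc x)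
  refine ⟨fun j => hFm.comp (hZm j), hind.comp (fun _ => _) fun _ => hFm, fun j ω => ⟨ha _, hc _⟩, fun j => ?_⟩
  rw [integral_comp_eq_of_map_eq (hZm j) (hlaw j) hFm]
  exact crnLag_integral_snd_eq hw0 Khat hK ν hf hC k

/-- **ANYTIME HOEFFDING FOR THE READ-OUTS OF PARALLEL RUNS**: `2·exp(−2Rε_R²/(c − a)²) ≤ δ_R` for `R ≥ 1`, `δ ≥ 0` summable ⇒
`P(∃ R ≥ 1, |R⁻¹Σ_{j<R} f(Y_k^{(j)}) − m_k| ≥ ε_R) ≤ Σ_R δ_R`. [ours] -/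
theorem crnLag_replicas_readout_hoeffding_abs_anytime [Fact (Measurable w)] (hw0 : ∀ y, 0 < w y)
    (Khat : Kernel (Ω × Ω) (Ω × Ω)) [IsMarkovKernel Khat]
    (hK : ∀ z : Ω × Ω, Khat z = (q.prod (volume : Measure unitInterval)).map (fun p : Ω × unitInterval =>
      ((if (p.2 : ℝ) * w z.1 ≤ w p.1 then p.1 else z.1), (if (p.2 : ℝ) * w z.2 ≤ w p.1 then p.1 else z.2))))
    (ν : Measure (Ω × Ω)) [IsProbabilityMeasure ν] {f : Ω → ℝ} (hf : Measurable f) {a c : ℝ} (ha : ∀ x, a ≤ f x)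
    (hc : ∀ x, f x ≤ c) (k : ℕ) (hZm : ∀ j, Measurable (Z j))
    (hlaw : ∀ j, μ.map (Z j) = Kernel.trajMeasure (X := fun _ : ℕ => Ω × Ω) ν
      (fun n : ℕ => Khat.comap (fun h : (i : ↥(Finset.Iic n)) → Ω × Ω => h ⟨n, Finset.mem_Iic.2 le_rfl⟩)
        (measurable_pi_apply _)))
    (hind : iIndepFun Z μ) {ε δ : ℕ → ℝ} (hε : ∀ R, 0 ≤ ε R) (hδ0 : ∀ R, 0 ≤ δ R)
    (hδ : ∀ R, 1 ≤ R → 2 * Real.exp (-(2 * R * ε R ^ 2) / (c - a) ^ 2) ≤ δ R) (hs : Summable δ) :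
    μ.real {ω | ∃ R, 1 ≤ R ∧ ε R ≤ |(R : ℝ)⁻¹ * ∑ j ∈ range R, f ((Z j ω k).2) -
        ∫ y, f y ∂((fun m : Measure Ω => m.bind (indepMH q w))^[k] (ν.map Prod.snd))|} ≤ ∑' R, δ R := by
  obtain ⟨hXm, hXi, hbd, hmean⟩ := crnLag_replicas_readout_facts hw0 Khat hK ν hf ha hc k hZm hlaw hind
  exact hoeffding_avg_abs_anytime hXm hXi hbd hmean hε hδ0 hδ hs

/-- **ANYTIME BERNSTEIN FOR THE READ-OUTS OF PARALLEL RUNS**: `σ² ≥ Var_{ν̂₂K^k} f`, `σ² > 0`,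
`2·exp(−Rε_R²/(2(σ² + (c − a)ε_R/3))) ≤ δ_R` for `R ≥ 1`, `δ ≥ 0` summable ⇒ `P(∃ R ≥ 1, |R⁻¹Σ_{j<R} f(Y_k^{(j)}) − m_k| ≥ ε_R) ≤ Σ_R δ_R`.
[ours] -/
theorem crnLag_replicas_readout_bernstein_abs_anytime [Fact (Measurable w)] (hw0 : ∀ y, 0 < w y)
    (Khat : Kernel (Ω × Ω) (Ω × Ω)) [IsMarkovKernel Khat]
    (hK : ∀ z : Ω × Ω, Khat z = (q.prod (volume : Measure unitInterval)).map (fun p : Ω × unitInterval =>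
      ((if (p.2 : ℝ) * w z.1 ≤ w p.1 then p.1 else z.1), (if (p.2 : ℝ) * w z.2 ≤ w p.1 then p.1 else z.2))))
    (ν : Measure (Ω × Ω)) [IsProbabilityMeasure ν] {f : Ω → ℝ} (hf : Measurable f) {a c : ℝ} (ha : ∀ x, a ≤ f x)
    (hc : ∀ x, f x ≤ c) (k : ℕ) (hZm : ∀ j, Measurable (Z j))
    (hlaw : ∀ j, μ.map (Z j) = Kernel.trajMeasure (X := fun _ : ℕ => Ω × Ω) ν
      (fun n : ℕ => Khat.comap (fun h : (i : ↥(Finset.Iic n)) → Ω × Ω => h ⟨n, Finset.mem_Iic.2 le_rfl⟩)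
        (measurable_pi_apply _)))
    (hind : iIndepFun Z μ) {σ2 : ℝ} (hσ : 0 < σ2)
    (hσk : variance f ((fun m : Measure Ω => m.bind (indepMH q w))^[k] (ν.map Prod.snd)) ≤ σ2)
    {ε δ : ℕ → ℝ} (hε : ∀ R, 0 ≤ ε R) (hδ0 : ∀ R, 0 ≤ δ R)
    (hδ : ∀ R, 1 ≤ R → 2 * Real.exp (-(R * ε R ^ 2) / (2 * (σ2 + (c - a) * ε R / 3))) ≤ δ R) (hs : Summable δ) :
    μ.real {ω | ∃ R, 1 ≤ R ∧ ε R ≤ |(R : ℝ)⁻¹ * ∑ j ∈ range R, f ((Z j ω k).2) -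
        ∫ y, f y ∂((fun m : Measure Ω => m.bind (indepMH q w))^[k] (ν.map Prod.snd))|} ≤ ∑' R, δ R := by
  obtain ⟨hXm, hXi, hbd, hmean⟩ := crnLag_replicas_readout_facts hw0 Khat hK ν hf ha hc k hZm hlaw hind
  haveI : IsProbabilityMeasure (ν.map Prod.snd) := Measure.isProbabilityMeasure_map measurable_snd.aemeasurable
  haveI := isProbabilityMeasure_iterate_bind (κ := indepMH q w) (ν.map Prod.snd) k
  set mk := ∫ y, f y ∂((fun m : Measure Ω => m.bind (indepMH q w))^[k] (ν.map Prod.snd)) with hmk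
  have hC : ∀ x, |f x| ≤ max |a| |c| := fun x => abs_le_max_abs_abs (ha x) (hc x)
  have hfi : Integrable f ((fun m : Measure Ω => m.bind (indepMH q w))^[k] (ν.map Prod.snd)) :=
    Integrable.of_bound hf.aestronglyMeasurable (max |a| |c|) (ae_of_all _ fun x => by rw [Real.norm_eq_abs]; exact hC x)
  have hmk_mem : a ≤ mk ∧ mk ≤ c := by
    constructor
    · calc a = ∫ _, a ∂((fun m : Measure Ω => m.bind (indepMH q w))^[k] (ν.map Prod.snd)) := by simp
        _ ≤ mk := integral_mono (integrable_const _) hfi ha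
    · calc mk ≤ ∫ _, c ∂((fun m : Measure Ω => m.bind (indepMH q w))^[k] (ν.map Prod.snd)) := integral_mono hfi (integrable_const _) hc
        _ = c := by simp
  have hbd' : ∀ j ω, |f ((Z j ω k).2) - mk| ≤ c - a := fun j ω =>
    abs_sub_le_iff.2 ⟨by linarith [hc (Z j ω k).2, hmk_mem.1], by linarith [ha (Z j ω k).2, hmk_mem.2]⟩
  have hvar : ∀ j, variance (fun ω => f ((Z j ω k).2)) μ ≤ σ2 := fun j => by
    rw [crnLag_replica_readout_variance_eq hw0 Khat hK ν hf ha hc k (hZm j) (hlaw j)]; exact hσk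
  exact bernstein_avg_abs_anytime hXm hXi hmean hbd' hσ hvar hε hδ0 hδ hs
/-! ## §2 Readouts about `π f` from the practical start, every weight -/

/-- **THE PARALLEL-SHORT-RUNS ESTIMATE HAS AN ANYTIME HOEFFDING BAR ABOUT `π f` — EVERY WEIGHT, EVERY PROPOSAL LAW**: standard Borel `Ω`;
production runs from `x` with `w(x) ≤ M` (pair streams from `ν̂_x = K(x, ·)∘(y ↦ (y, x))⁻¹`, whose production coordinate is the run from
`x`), read after `k` updates; `τ = π{M < w} + (1 − c₁/max(1, M))^k`; radii and schedule as in §1: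
`P(∃ R ≥ 1, |R⁻¹Σ_{j<R} f(Y_k^{(j)}) − π f| ≥ ε_R + (c − a)τ) ≤ Σ_R δ_R` — no coupling term. [ours] -/
theorem imh_replicas_readout_hoeffding_abs_anytime_target_everyWeight [StandardBorelSpace Ω] [Nonempty Ω] [MeasurableSingletonClass Ω]
    [MeasurableEq Ω] [Fact (Measurable w)] (hw0 : ∀ y, 0 < w y) [IsProbabilityMeasure (q.withDensity fun y => ENNReal.ofReal (w y))]
    (Khat : Kernel (Ω × Ω) (Ω × Ω)) [IsMarkovKernel Khat]
    (hK : ∀ z : Ω × Ω, Khat z = (q.prod (volume : Measure unitInterval)).map (fun p : Ω × unitInterval =>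
      ((if (p.2 : ℝ) * w z.1 ≤ w p.1 then p.1 else z.1), (if (p.2 : ℝ) * w z.2 ≤ w p.1 then p.1 else z.2))))
    (x : Ω) {M : ℝ} (hxM : w x ≤ M) (ν : Measure (Ω × Ω)) [IsProbabilityMeasure ν]
    (hν : ν = (indepMH q w x).map fun y : Ω => (y, x)) {f : Ω → ℝ} (hf : Measurable f) {a c : ℝ} (ha : ∀ y, a ≤ f y)
    (hc : ∀ y, f y ≤ c) (k : ℕ) (hZm : ∀ j, Measurable (Z j))
    (hlaw : ∀ j, μ.map (Z j) = Kernel.trajMeasure (X := fun _ : ℕ => Ω × Ω) ν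
      (fun n : ℕ => Khat.comap (fun h : (i : ↥(Finset.Iic n)) → Ω × Ω => h ⟨n, Finset.mem_Iic.2 le_rfl⟩)
        (measurable_pi_apply _)))
    (hind : iIndepFun Z μ) {ε δ : ℕ → ℝ} (hε : ∀ R, 0 ≤ ε R) (hδ0 : ∀ R, 0 ≤ δ R)
    (hδ : ∀ R, 1 ≤ R → 2 * Real.exp (-(2 * R * ε R ^ 2) / (c - a) ^ 2) ≤ δ R) (hs : Summable δ) :
    μ.real {ω | ∃ R, 1 ≤ R ∧ ε R + (c - a) * ((q.withDensity fun y => ENNReal.ofReal (w y)) {y | M < w y} +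
          (1 - (∫⁻ y, ENNReal.ofReal (min 1 (w y)) ∂q) / ENNReal.ofReal (max 1 M)) ^ k).toReal ≤
        |(R : ℝ)⁻¹ * ∑ j ∈ range R, f ((Z j ω k).2) - ∫ y, f y ∂(q.withDensity fun y => ENNReal.ofReal (w y))|} ≤
      ∑' R, δ R := by
  have hw : Measurable w := Fact.out; have hφ : Measurable fun y : Ω => (y, x) := measurable_id.prodMk measurable_const
  set c₁ := ∫⁻ y, ENNReal.ofReal (min 1 (w y)) ∂q with hc₁; set r : ℝ≥0∞ := (1 - c₁ / ENNReal.ofReal (max 1 M)) ^ k with hr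
  have hsnd : ν.map Prod.snd = Measure.dirac x := by
    rw [hν, Measure.map_map measurable_snd hφ]
    have : (Prod.snd ∘ fun y : Ω => (y, x)) = fun _ => x := rfl
    rw [this, Measure.map_const, measure_univ, one_smul]
  set πm : Measure Ω := q.withDensity fun y => ENNReal.ofReal (w y) with hπm
  set mk := ∫ y, f y ∂((fun m : Measure Ω => m.bind (indepMH q w))^[k] (Measure.dirac x)) with hmk
  set πf := ∫ y, f y ∂πm with hπf
  have h := crnLag_replicas_readout_hoeffding_abs_anytime hw0 Khat hK ν hf ha hc k hZm hlaw hind hε hδ0 hδ hs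
  rw [hsnd] at h
  have hbias : |mk - πf| ≤ (c - a) * (πm {y | M < w y} + r).toReal := by
    have hb := imh_everyStart_integral_sub_abs_le_tail (q := q) hw hw0 x hf ha hc k M
    rw [max_eq_right hxM, abs_sub_comm] at hb
    exact hb
  refine (measureReal_mono fun ω hω => ?_).trans h
  simp only [Set.mem_setOf_eq] at hω ⊢
  obtain ⟨R, hR1, hR⟩ := hω
  refine ⟨R, hR1, ?_⟩
  have htri : |(R : ℝ)⁻¹ * ∑ j ∈ range R, f ((Z j ω k).2) - πf| ≤
      |(R : ℝ)⁻¹ * ∑ j ∈ range R, f ((Z j ω k).2) - mk| + |mk - πf| := abs_sub_le _ mk πf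
  linarith

/-- **… AND AN ANYTIME BERNSTEIN BAR AT THE EQUILIBRIUM VARIANCE**: same setting, `Var_π f + 3(c − a)²τ ≤ σ²`, `σ² > 0`,
`2·exp(−Rε_R²/(2(σ² + (c − a)ε_R/3))) ≤ δ_R` for `R ≥ 1` ⇒ `P(∃ R ≥ 1, |R⁻¹Σ_{j<R} f(Y_k^{(j)}) − π f| ≥ ε_R + (c − a)τ) ≤ Σ_R δ_R`. [ours] -/
theorem imh_replicas_readout_bernstein_abs_anytime_target_equilibrium_everyWeight [StandardBorelSpace Ω] [Nonempty Ω]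
    [MeasurableSingletonClass Ω] [MeasurableEq Ω] [Fact (Measurable w)] (hw0 : ∀ y, 0 < w y)
    [IsProbabilityMeasure (q.withDensity fun y => ENNReal.ofReal (w y))]
    (Khat : Kernel (Ω × Ω) (Ω × Ω)) [IsMarkovKernel Khat]
    (hK : ∀ z : Ω × Ω, Khat z = (q.prod (volume : Measure unitInterval)).map (fun p : Ω × unitInterval =>
      ((if (p.2 : ℝ) * w z.1 ≤ w p.1 then p.1 else z.1), (if (p.2 : ℝ) * w z.2 ≤ w p.1 then p.1 else z.2))))
    (x : Ω) {M : ℝ} (hxM : w x ≤ M) (ν : Measure (Ω × Ω)) [IsProbabilityMeasure ν]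
    (hν : ν = (indepMH q w x).map fun y : Ω => (y, x)) {f : Ω → ℝ} (hf : Measurable f) {a c : ℝ} (ha : ∀ y, a ≤ f y)
    (hc : ∀ y, f y ≤ c) (k : ℕ) (hZm : ∀ j, Measurable (Z j))
    (hlaw : ∀ j, μ.map (Z j) = Kernel.trajMeasure (X := fun _ : ℕ => Ω × Ω) ν
      (fun n : ℕ => Khat.comap (fun h : (i : ↥(Finset.Iic n)) → Ω × Ω => h ⟨n, Finset.mem_Iic.2 le_rfl⟩)
        (measurable_pi_apply _)))
    (hind : iIndepFun Z μ) {σ2 : ℝ} (hσ : 0 < σ2)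
    (hσπ : variance f (q.withDensity fun y => ENNReal.ofReal (w y)) +
      3 * ((c - a) ^ 2 * ((q.withDensity fun y => ENNReal.ofReal (w y)) {y | M < w y} +
        (1 - (∫⁻ y, ENNReal.ofReal (min 1 (w y)) ∂q) / ENNReal.ofReal (max 1 M)) ^ k).toReal) ≤ σ2)
    {ε δ : ℕ → ℝ} (hε : ∀ R, 0 ≤ ε R) (hδ0 : ∀ R, 0 ≤ δ R)
    (hδ : ∀ R, 1 ≤ R → 2 * Real.exp (-(R * ε R ^ 2) / (2 * (σ2 + (c - a) * ε R / 3))) ≤ δ R) (hs : Summable δ) :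
    μ.real {ω | ∃ R, 1 ≤ R ∧ ε R + (c - a) * ((q.withDensity fun y => ENNReal.ofReal (w y)) {y | M < w y} +
          (1 - (∫⁻ y, ENNReal.ofReal (min 1 (w y)) ∂q) / ENNReal.ofReal (max 1 M)) ^ k).toReal ≤
        |(R : ℝ)⁻¹ * ∑ j ∈ range R, f ((Z j ω k).2) - ∫ y, f y ∂(q.withDensity fun y => ENNReal.ofReal (w y))|} ≤
      ∑' R, δ R := by
  have hw : Measurable w := Fact.out; have hφ : Measurable fun y : Ω => (y, x) := measurable_id.prodMk measurable_const
  set c₁ := ∫⁻ y, ENNReal.ofReal (min 1 (w y)) ∂q with hc₁; set r : ℝ≥0∞ := (1 - c₁ / ENNReal.ofReal (max 1 M)) ^ k with hr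
  have hsnd : ν.map Prod.snd = Measure.dirac x := by
    rw [hν, Measure.map_map measurable_snd hφ]
    have : (Prod.snd ∘ fun y : Ω => (y, x)) = fun _ => x := rfl
    rw [this, Measure.map_const, measure_univ, one_smul]
  set πm : Measure Ω := q.withDensity fun y => ENNReal.ofReal (w y) with hπm
  set mk := ∫ y, f y ∂((fun m : Measure Ω => m.bind (indepMH q w))^[k] (Measure.dirac x)) with hmk
  set πf := ∫ y, f y ∂πm with hπf
  -- the variance after `k` updates from `x` is at most the equilibrium variance plus the tail allowance
  have hσk : variance f ((fun m : Measure Ω => m.bind (indepMH q w))^[k] (ν.map Prod.snd)) ≤ σ2 := by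
    rw [hsnd]
    have hv := variance_iterate_bind_indepMH_dirac_le_tail (q := q) hw hw0 x hf ha hc k M
    rw [max_eq_right hxM] at hv
    exact hv.trans hσπ
  have h := crnLag_replicas_readout_bernstein_abs_anytime hw0 Khat hK ν hf ha hc k hZm hlaw hind hσ hσk hε hδ0 hδ hs
  rw [hsnd] at h
  have hbias : |mk - πf| ≤ (c - a) * (πm {y | M < w y} + r).toReal := by
    have hb := imh_everyStart_integral_sub_abs_le_tail (q := q) hw hw0 x hf ha hc k M
    rw [max_eq_right hxM, abs_sub_comm] at hb
    exact hb
  refine (measureReal_mono fun ω hω => ?_).trans h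
  simp only [Set.mem_setOf_eq] at hω ⊢
  obtain ⟨R, hR1, hR⟩ := hω
  refine ⟨R, hR1, ?_⟩
  have htri : |(R : ℝ)⁻¹ * ∑ j ∈ range R, f ((Z j ω k).2) - πf| ≤
      |(R : ℝ)⁻¹ * ∑ j ∈ range R, f ((Z j ω k).2) - mk| + |mk - πf| := abs_sub_le _ mk πf
  linarith
/-! ## §3 The coupled estimator within a declared budget of replicas -/

omit [MeasurableSpace Ω] in
/-- Off the event that one of the first `R_max` replicas carries a correction on the window, EVERY partial coupled average `H̄_R`,
`R ≤ R_max`, equals the read-out average. [ours, bookkeeping] -/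
theorem crnLag_partial_avg_eq_readout_of_forall {f : Ω → ℝ} {k N Rmax : ℕ} {z : ℕ → ℕ → Ω × Ω}
    (hzero : ∀ j, j < Rmax → ∑ n ∈ range N, (f ((z j (k + n)).1) - f ((z j (k + n)).2)) = 0) {R : ℕ} (hR : R ≤ Rmax) :
    ∑ j ∈ range R, (f ((z j k).2) + ∑ n ∈ range N, (f ((z j (k + n)).1) - f ((z j (k + n)).2))) =
      ∑ j ∈ range R, f ((z j k).2) :=
  sum_congr rfl fun j hj => by rw [hzero j (lt_of_lt_of_le (mem_range.1 hj) hR), add_zero]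

/-- **ANYTIME-WITHIN-BUDGET HOEFFDING FOR THE COUPLED ESTIMATOR, EVERY WEIGHT, EVERY INITIAL COUPLING**: window `N`, burn-in `k`,
declared budget `R_max`; `2·exp(−2Rε_R²/(c − a)²) ≤ δ_R` for `R ≥ 1`, `δ ≥ 0` summable ⇒
`P(∃ 1 ≤ R ≤ R_max, |H̄_R − m_k| ≥ ε_R) ≤ Σ_R δ_R + R_max·(ν̂K̂^k)(Δᶜ)`. [ours] -/
theorem crnLag_replicas_burnIn_hoeffding_abs_anytime_budget [MeasurableEq Ω] [Fact (Measurable w)] (hw0 : ∀ y, 0 < w y)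
    (Khat : Kernel (Ω × Ω) (Ω × Ω)) [IsMarkovKernel Khat]
    (hK : ∀ z : Ω × Ω, Khat z = (q.prod (volume : Measure unitInterval)).map (fun p : Ω × unitInterval =>
      ((if (p.2 : ℝ) * w z.1 ≤ w p.1 then p.1 else z.1), (if (p.2 : ℝ) * w z.2 ≤ w p.1 then p.1 else z.2))))
    (ν : Measure (Ω × Ω)) [IsProbabilityMeasure ν] {f : Ω → ℝ} (hf : Measurable f) {a c : ℝ} (ha : ∀ x, a ≤ f x)
    (hc : ∀ x, f x ≤ c) (k N Rmax : ℕ) (hZm : ∀ j, Measurable (Z j))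
    (hlaw : ∀ j, μ.map (Z j) = Kernel.trajMeasure (X := fun _ : ℕ => Ω × Ω) ν
      (fun n : ℕ => Khat.comap (fun h : (i : ↥(Finset.Iic n)) → Ω × Ω => h ⟨n, Finset.mem_Iic.2 le_rfl⟩)
        (measurable_pi_apply _)))
    (hind : iIndepFun Z μ) {ε δ : ℕ → ℝ} (hε : ∀ R, 0 ≤ ε R) (hδ0 : ∀ R, 0 ≤ δ R)
    (hδ : ∀ R, 1 ≤ R → 2 * Real.exp (-(2 * R * ε R ^ 2) / (c - a) ^ 2) ≤ δ R) (hs : Summable δ) :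
    μ.real {ω | ∃ R, 1 ≤ R ∧ R ≤ Rmax ∧ ε R ≤ |(R : ℝ)⁻¹ * ∑ j ∈ range R, (f ((Z j ω k).2) +
        ∑ n ∈ range N, (f ((Z j ω (k + n)).1) - f ((Z j ω (k + n)).2))) -
          ∫ y, f y ∂((fun m : Measure Ω => m.bind (indepMH q w))^[k] (ν.map Prod.snd))|} ≤
      ∑' R, δ R + Rmax * ((fun m : Measure (Ω × Ω) => m.bind Khat)^[k] ν).real (Set.diagonal Ω)ᶜ := by
  have hw : Measurable w := Fact.out
  set mk := ∫ y, f y ∂((fun m : Measure Ω => m.bind (indepMH q w))^[k] (ν.map Prod.snd)) with hmk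
  set B : Set Ω' := ⋃ j ∈ range Rmax, {ω | ∑ n ∈ range N, (f ((Z j ω (k + n)).1) - f ((Z j ω (k + n)).2)) ≠ 0} with hB
  have hsub : {ω | ∃ R, 1 ≤ R ∧ R ≤ Rmax ∧ ε R ≤ |(R : ℝ)⁻¹ * ∑ j ∈ range R, (f ((Z j ω k).2) +
        ∑ n ∈ range N, (f ((Z j ω (k + n)).1) - f ((Z j ω (k + n)).2))) - mk|}
      ⊆ B ∪ {ω | ∃ R, 1 ≤ R ∧ ε R ≤ |(R : ℝ)⁻¹ * ∑ j ∈ range R, f ((Z j ω k).2) - mk|} := by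
    intro ω hω
    by_cases hωB : ω ∈ B
    · exact Or.inl hωB
    · right
      have hzero : ∀ j, j < Rmax → ∑ n ∈ range N, (f ((Z j ω (k + n)).1) - f ((Z j ω (k + n)).2)) = 0 := by
        intro j hj
        by_contra hne
        exact hωB (Set.mem_biUnion (show j ∈ (range Rmax : Set ℕ) from by exact_mod_cast mem_range.2 hj) hne)
      simp only [Set.mem_setOf_eq] at hω ⊢
      obtain ⟨R, hR1, hRm, hR⟩ := hω
      refine ⟨R, hR1, ?_⟩
      rwa [crnLag_partial_avg_eq_readout_of_forall (z := fun j => Z j ω) hzero hRm] at hR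
  have h1 := crnLag_replicas_some_correction_le_offDiagonal hw hw0 Khat hK ν hf k N hZm hlaw Rmax
  have h2 := crnLag_replicas_readout_hoeffding_abs_anytime hw0 Khat hK ν hf ha hc k hZm hlaw hind hε hδ0 hδ hs
  calc μ.real {ω | ∃ R, 1 ≤ R ∧ R ≤ Rmax ∧ ε R ≤ |(R : ℝ)⁻¹ * ∑ j ∈ range R, (f ((Z j ω k).2) +
        ∑ n ∈ range N, (f ((Z j ω (k + n)).1) - f ((Z j ω (k + n)).2))) - mk|}
      ≤ μ.real (B ∪ {ω | ∃ R, 1 ≤ R ∧ ε R ≤ |(R : ℝ)⁻¹ * ∑ j ∈ range R, f ((Z j ω k).2) - mk|}) := measureReal_mono hsub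
    _ ≤ μ.real B + μ.real {ω | ∃ R, 1 ≤ R ∧ ε R ≤ |(R : ℝ)⁻¹ * ∑ j ∈ range R, f ((Z j ω k).2) - mk|} :=
        measureReal_union_le _ _
    _ ≤ ∑' R, δ R + Rmax * ((fun m : Measure (Ω × Ω) => m.bind Khat)^[k] ν).real (Set.diagonal Ω)ᶜ := by linarith

/-- **ANYTIME-WITHIN-BUDGET BERNSTEIN FOR THE COUPLED ESTIMATOR, EVERY WEIGHT, EVERY INITIAL COUPLING**: `σ² ≥ Var_{ν̂₂K^k} f`, `σ² > 0`,
`2·exp(−Rε_R²/(2(σ² + (c − a)ε_R/3))) ≤ δ_R` for `R ≥ 1`, `δ ≥ 0` summable ⇒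
`P(∃ 1 ≤ R ≤ R_max, |H̄_R − m_k| ≥ ε_R) ≤ Σ_R δ_R + R_max·(ν̂K̂^k)(Δᶜ)`. [ours] -/
theorem crnLag_replicas_burnIn_bernstein_abs_anytime_budget [MeasurableEq Ω] [Fact (Measurable w)] (hw0 : ∀ y, 0 < w y)
    (Khat : Kernel (Ω × Ω) (Ω × Ω)) [IsMarkovKernel Khat]
    (hK : ∀ z : Ω × Ω, Khat z = (q.prod (volume : Measure unitInterval)).map (fun p : Ω × unitInterval =>
      ((if (p.2 : ℝ) * w z.1 ≤ w p.1 then p.1 else z.1), (if (p.2 : ℝ) * w z.2 ≤ w p.1 then p.1 else z.2))))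
    (ν : Measure (Ω × Ω)) [IsProbabilityMeasure ν] {f : Ω → ℝ} (hf : Measurable f) {a c : ℝ} (ha : ∀ x, a ≤ f x)
    (hc : ∀ x, f x ≤ c) (k N Rmax : ℕ) (hZm : ∀ j, Measurable (Z j))
    (hlaw : ∀ j, μ.map (Z j) = Kernel.trajMeasure (X := fun _ : ℕ => Ω × Ω) ν
      (fun n : ℕ => Khat.comap (fun h : (i : ↥(Finset.Iic n)) → Ω × Ω => h ⟨n, Finset.mem_Iic.2 le_rfl⟩)
        (measurable_pi_apply _)))
    (hind : iIndepFun Z μ) {σ2 : ℝ} (hσ : 0 < σ2)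
    (hσk : variance f ((fun m : Measure Ω => m.bind (indepMH q w))^[k] (ν.map Prod.snd)) ≤ σ2)
    {ε δ : ℕ → ℝ} (hε : ∀ R, 0 ≤ ε R) (hδ0 : ∀ R, 0 ≤ δ R)
    (hδ : ∀ R, 1 ≤ R → 2 * Real.exp (-(R * ε R ^ 2) / (2 * (σ2 + (c - a) * ε R / 3))) ≤ δ R) (hs : Summable δ) :
    μ.real {ω | ∃ R, 1 ≤ R ∧ R ≤ Rmax ∧ ε R ≤ |(R : ℝ)⁻¹ * ∑ j ∈ range R, (f ((Z j ω k).2) +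
        ∑ n ∈ range N, (f ((Z j ω (k + n)).1) - f ((Z j ω (k + n)).2))) -
          ∫ y, f y ∂((fun m : Measure Ω => m.bind (indepMH q w))^[k] (ν.map Prod.snd))|} ≤
      ∑' R, δ R + Rmax * ((fun m : Measure (Ω × Ω) => m.bind Khat)^[k] ν).real (Set.diagonal Ω)ᶜ := by
  have hw : Measurable w := Fact.out
  set mk := ∫ y, f y ∂((fun m : Measure Ω => m.bind (indepMH q w))^[k] (ν.map Prod.snd)) with hmk
  set B : Set Ω' := ⋃ j ∈ range Rmax, {ω | ∑ n ∈ range N, (f ((Z j ω (k + n)).1) - f ((Z j ω (k + n)).2)) ≠ 0} with hB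
  have hsub : {ω | ∃ R, 1 ≤ R ∧ R ≤ Rmax ∧ ε R ≤ |(R : ℝ)⁻¹ * ∑ j ∈ range R, (f ((Z j ω k).2) +
        ∑ n ∈ range N, (f ((Z j ω (k + n)).1) - f ((Z j ω (k + n)).2))) - mk|}
      ⊆ B ∪ {ω | ∃ R, 1 ≤ R ∧ ε R ≤ |(R : ℝ)⁻¹ * ∑ j ∈ range R, f ((Z j ω k).2) - mk|} := by
    intro ω hω
    by_cases hωB : ω ∈ B
    · exact Or.inl hωB
    · right
      have hzero : ∀ j, j < Rmax → ∑ n ∈ range N, (f ((Z j ω (k + n)).1) - f ((Z j ω (k + n)).2)) = 0 := by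
        intro j hj
        by_contra hne
        exact hωB (Set.mem_biUnion (show j ∈ (range Rmax : Set ℕ) from by exact_mod_cast mem_range.2 hj) hne)
      simp only [Set.mem_setOf_eq] at hω ⊢
      obtain ⟨R, hR1, hRm, hR⟩ := hω
      refine ⟨R, hR1, ?_⟩
      rwa [crnLag_partial_avg_eq_readout_of_forall (z := fun j => Z j ω) hzero hRm] at hR
  have h1 := crnLag_replicas_some_correction_le_offDiagonal hw hw0 Khat hK ν hf k N hZm hlaw Rmax
  have h2 := crnLag_replicas_readout_bernstein_abs_anytime hw0 Khat hK ν hf ha hc k hZm hlaw hind hσ hσk hε hδ0 hδ hs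
  calc μ.real {ω | ∃ R, 1 ≤ R ∧ R ≤ Rmax ∧ ε R ≤ |(R : ℝ)⁻¹ * ∑ j ∈ range R, (f ((Z j ω k).2) +
        ∑ n ∈ range N, (f ((Z j ω (k + n)).1) - f ((Z j ω (k + n)).2))) - mk|}
      ≤ μ.real (B ∪ {ω | ∃ R, 1 ≤ R ∧ ε R ≤ |(R : ℝ)⁻¹ * ∑ j ∈ range R, f ((Z j ω k).2) - mk|}) := measureReal_mono hsub
    _ ≤ μ.real B + μ.real {ω | ∃ R, 1 ≤ R ∧ ε R ≤ |(R : ℝ)⁻¹ * ∑ j ∈ range R, f ((Z j ω k).2) - mk|} :=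
        measureReal_union_le _ _
    _ ≤ ∑' R, δ R + Rmax * ((fun m : Measure (Ω × Ω) => m.bind Khat)^[k] ν).real (Set.diagonal Ω)ᶜ := by linarith

/-- **ANYTIME-WITHIN-BUDGET BERNSTEIN BAR ABOUT `π f` FROM THE PRACTICAL START — EVERY WEIGHT**: standard Borel `Ω`; production run
at `x` with `w(x) ≤ M`, leading run one update ahead; window `N`, burn-in `k`, budget `R_max`; `σ² ≥ Var_{δ_xK^k} f`, `σ² > 0`;
`τ = π{M < w} + ρ^k`, `ρ = 1 − c₁/max(1, M)`; `2·exp(−Rε_R²/(2(σ² + (c − a)ε_R/3))) ≤ δ_R` for `R ≥ 1`, `δ ≥ 0` summable: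
`P(∃ 1 ≤ R ≤ R_max, |H̄_R − π f| ≥ ε_R + (c − a)τ) ≤ Σ_R δ_R + R_max·(q{M < w} + ρ^k)`. [ours] -/
theorem imh_replicas_burnIn_bernstein_abs_anytime_budget_target_everyWeight [StandardBorelSpace Ω] [Nonempty Ω]
    [MeasurableSingletonClass Ω] [MeasurableEq Ω] [Fact (Measurable w)] (hw0 : ∀ y, 0 < w y)
    [IsProbabilityMeasure (q.withDensity fun y => ENNReal.ofReal (w y))]
    (Khat : Kernel (Ω × Ω) (Ω × Ω)) [IsMarkovKernel Khat]
    (hK : ∀ z : Ω × Ω, Khat z = (q.prod (volume : Measure unitInterval)).map (fun p : Ω × unitInterval =>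
      ((if (p.2 : ℝ) * w z.1 ≤ w p.1 then p.1 else z.1), (if (p.2 : ℝ) * w z.2 ≤ w p.1 then p.1 else z.2))))
    (x : Ω) {M : ℝ} (hxM : w x ≤ M) (ν : Measure (Ω × Ω)) [IsProbabilityMeasure ν]
    (hν : ν = (indepMH q w x).map fun y : Ω => (y, x)) {f : Ω → ℝ} (hf : Measurable f) {a c : ℝ} (ha : ∀ y, a ≤ f y)
    (hc : ∀ y, f y ≤ c) (k N Rmax : ℕ) (hZm : ∀ j, Measurable (Z j))
    (hlaw : ∀ j, μ.map (Z j) = Kernel.trajMeasure (X := fun _ : ℕ => Ω × Ω) ν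
      (fun n : ℕ => Khat.comap (fun h : (i : ↥(Finset.Iic n)) → Ω × Ω => h ⟨n, Finset.mem_Iic.2 le_rfl⟩)
        (measurable_pi_apply _)))
    (hind : iIndepFun Z μ) {σ2 : ℝ} (hσ : 0 < σ2)
    (hσk : variance f ((fun m : Measure Ω => m.bind (indepMH q w))^[k] (Measure.dirac x)) ≤ σ2)
    {ε δ : ℕ → ℝ} (hε : ∀ R, 0 ≤ ε R) (hδ0 : ∀ R, 0 ≤ δ R)
    (hδ : ∀ R, 1 ≤ R → 2 * Real.exp (-(R * ε R ^ 2) / (2 * (σ2 + (c - a) * ε R / 3))) ≤ δ R) (hs : Summable δ) :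
    μ.real {ω | ∃ R, 1 ≤ R ∧ R ≤ Rmax ∧ ε R + (c - a) * ((q.withDensity fun y => ENNReal.ofReal (w y)) {y | M < w y} +
          (1 - (∫⁻ y, ENNReal.ofReal (min 1 (w y)) ∂q) / ENNReal.ofReal (max 1 M)) ^ k).toReal ≤
        |(R : ℝ)⁻¹ * ∑ j ∈ range R, (f ((Z j ω k).2) + ∑ n ∈ range N, (f ((Z j ω (k + n)).1) - f ((Z j ω (k + n)).2))) -
          ∫ y, f y ∂(q.withDensity fun y => ENNReal.ofReal (w y))|} ≤
      ∑' R, δ R + Rmax * (q {y | M < w y} + (1 - (∫⁻ y, ENNReal.ofReal (min 1 (w y)) ∂q) / ENNReal.ofReal (max 1 M)) ^ k).toReal := by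
  have hw : Measurable w := Fact.out; have hφ : Measurable fun y : Ω => (y, x) := measurable_id.prodMk measurable_const
  set c₁ := ∫⁻ y, ENNReal.ofReal (min 1 (w y)) ∂q with hc₁; set r : ℝ≥0∞ := (1 - c₁ / ENNReal.ofReal (max 1 M)) ^ k with hr
  have hr1 : r ≤ 1 := (pow_le_pow_left' tsub_le_self k).trans_eq (one_pow k)
  have hsnd : ν.map Prod.snd = Measure.dirac x := by
    rw [hν, Measure.map_map measurable_snd hφ]
    have : (Prod.snd ∘ fun y : Ω => (y, x)) = fun _ => x := rfl
    rw [this, Measure.map_const, measure_univ, one_smul]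
  set πm : Measure Ω := q.withDensity fun y => ENNReal.ofReal (w y) with hπm
  set mk := ∫ y, f y ∂((fun m : Measure Ω => m.bind (indepMH q w))^[k] (Measure.dirac x)) with hmk
  set πf := ∫ y, f y ∂πm with hπf
  set X : ℕ → Ω' → ℝ := fun j ω => f ((Z j ω k).2) + ∑ n ∈ range N, (f ((Z j ω (k + n)).1) - f ((Z j ω (k + n)).2)) with hX
  have hσk' : variance f ((fun m : Measure Ω => m.bind (indepMH q w))^[k] (ν.map Prod.snd)) ≤ σ2 := by rw [hsnd]; exact hσk
  have h := crnLag_replicas_burnIn_bernstein_abs_anytime_budget hw0 Khat hK ν hf ha hc k N Rmax hZm hlaw hind hσ hσk' hε hδ0 hδ hs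
  rw [hsnd] at h
  have hoff : ((fun m : Measure (Ω × Ω) => m.bind Khat)^[k] ν).real (Set.diagonal Ω)ᶜ ≤ (q {y | M < w y} + r).toReal := by
    rw [measureReal_def]
    exact ENNReal.toReal_mono (ENNReal.add_ne_top.2 ⟨measure_ne_top q _, ne_top_of_le_ne_top ENNReal.one_ne_top hr1⟩)
      (iterate_bind_crnPair_offDiagonal_detLag_le_tail hw hw0 Khat hK x hxM ν hν k)
  have hbias : |mk - πf| ≤ (c - a) * (πm {y | M < w y} + r).toReal := by
    have hb := imh_everyStart_integral_sub_abs_le_tail (q := q) hw hw0 x hf ha hc k M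
    rw [max_eq_right hxM, abs_sub_comm] at hb
    exact hb
  have hsub : {ω | ∃ R, 1 ≤ R ∧ R ≤ Rmax ∧ ε R + (c - a) * (πm {y | M < w y} + r).toReal ≤
        |(R : ℝ)⁻¹ * ∑ j ∈ range R, X j ω - πf|} ⊆
      {ω | ∃ R, 1 ≤ R ∧ R ≤ Rmax ∧ ε R ≤ |(R : ℝ)⁻¹ * ∑ j ∈ range R, X j ω - mk|} := by
    intro ω hω
    simp only [Set.mem_setOf_eq] at hω ⊢
    obtain ⟨R, hR1, hRm, hR⟩ := hω
    refine ⟨R, hR1, hRm, ?_⟩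
    have htri : |(R : ℝ)⁻¹ * ∑ j ∈ range R, X j ω - πf| ≤ |(R : ℝ)⁻¹ * ∑ j ∈ range R, X j ω - mk| + |mk - πf| :=
      abs_sub_le ((R : ℝ)⁻¹ * ∑ j ∈ range R, X j ω) mk πf
    linarith
  calc μ.real {ω | ∃ R, 1 ≤ R ∧ R ≤ Rmax ∧ ε R + (c - a) * (πm {y | M < w y} + r).toReal ≤
        |(R : ℝ)⁻¹ * ∑ j ∈ range R, X j ω - πf|}
      ≤ μ.real {ω | ∃ R, 1 ≤ R ∧ R ≤ Rmax ∧ ε R ≤ |(R : ℝ)⁻¹ * ∑ j ∈ range R, X j ω - mk|} := measureReal_mono hsub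
    _ ≤ ∑' R, δ R + Rmax * ((fun m : Measure (Ω × Ω) => m.bind Khat)^[k] ν).real (Set.diagonal Ω)ᶜ := h
    _ ≤ ∑' R, δ R + Rmax * (q {y | M < w y} + r).toReal := by gcongr

end Replicas
end Summit.Ventures.LatticeQCDFlow.Exactness
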